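/- Copyright: the b2b-balaban cell (near-miss cell 7), T⁴-continuum fan-out; row NE7b CRUX team (2), seat
t4-ne7b-formalise-leaf-02 (gen 27) — E-side of the OWNER's INTERFACE REQUEST NE7b IR-44-1 («→ S12-W crew (leaf-03 custodian;
E-files leaf-02; leaf-05)», HOME/INBOX.md l.7662, `CLAIMS.log` l.30796 ∕ claim l.30887): item (3), THE WITNESS WITH THE WEIGHTED
CLASS REMAINDER, and its embedding into the owner's `κ := costT` witness.  Released under the licence of the surrounding project. -/
import Summits.QuantumFields.BalabanUV.T4Continuum.Support.HistoryRealiseCellsRunApexT3bWTV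
import Summits.QuantumFields.BalabanUV.T4Continuum.Support.HistoryBankingVolumePlug

/-!
# Realised histories: THE COUNT-ROAD WITNESS AT `κ := costT` WITH THE VOLUME'S WEIGHTED CLASS REMAINDER DISPLAYED, and its
embedding into the owner's `CountRoadWitnessT3bWTV` by RE-SLACKING print's `O(1)` record (IR-44-1 (3), E-side, witness level)

Summits-side support leaf of the T⁴-continuum cell (rung (B)+1 on a FINITE torus only; NOT infinite volume, NOT the mass
gap, NOT the Clay statement; NOT a proof of the spine estimate NE7b, which is the cell's OWN estimate, NOT PRINTED and NOT
PROVED).  [folklore] composition by name over the owner's row-S20 modules `HistoryRealiseCellsRunApexT3bWTV`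
(`CountRoadWitnessT3bWTV`, p263890) and `HistoryBankingVolumePlug` (`birthWT`, p263135) and the lineage's price letters
(`HistoryConstants.pcredit`, `HistoryConstantsTH.pshapeTH`); one `structure` (a hypothesis SHAPE: the owner's witness plus
two displayed fields), two `def`s (`reslack` — an [our object] change of the `O(1)` record —, and the embedding `toWTV`); no
`[cite:]` tag, nothing printed asserted, no `Prop` fact minted, zero `sorry`.  Append-only: the owner's WTV and E6T∕E7T stay,
UNCHANGED BY NAME.

WHY (IR-44-1).  After M5-2, `priceM` at `κ := costT` still reads (β) the volume's CLASS REMAINDER `e^{birthWT Prod.fst (2^{d+3}u) (genT c)}`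
(owner's `B16HistoryWeightPlug`, `HistoryBankingForestPlug`); the request asks for price sentences carrying `Real.exp (birthWT Prod.fst
(uV K) q.2)` under the display D-V1 `uV K j ≤ θᵥ·p₀(g_j)²` and the SPLIT slack `C.a + (θ + θᵥ) ≤ ½γ₀A₁²`.  LOCATED OBSERVATION: print's
`O(1)` record `O` enters the V-headline `continuumYM4Torus_of_countRoadT3bWTV_fsc` ONLY through `hslack : C.a + θ ≤ O.γ₀·O.A₁²∕2` and the
birth credit `pcredit O` inside `pshapeTH` (no `Dominates C O`, no `O.Pos` among its hypotheses).  So the remainder is ABSORBED INTO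
THE CREDIT RECORD: `reslack O θᵥ` (`γ₀ := O.γ₀·O.A₁² − 2θᵥ`, `A₁ := 1`, all else O's) gives a birth `(½γ₀A₁² − θᵥ)·p₀²·(d′+1) + 2p₀`,
renewals ∕ mergers unchanged; under D-V1 `credits (pcredit (reslack O θᵥ)) G + birthWT (uV K) G ≤ credits (pcredit O) G`, hence
`pshapeTH … O … q.2 · e^{birthWT (uV K) q.2} ≤ pshapeTH … (reslack O θᵥ) … q.2`: a weighted witness over `O` IS a `κ := costT` witness over
`reslack O θᵥ`, and `C.a + (θ + θᵥ) ≤ ½γ₀A₁²` IS `C.a + θ ≤ ½γ₀′A₁′²`.  The headline (sibling `HistoryRealiseCellsRunHeadlineT3bWTVS`) is the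
owner's V-headline at `reslack O θᵥ` — conclusion VERBATIM; the END-level twins of IR-44-1 (1)(2) stay the END-level record if wanted.

WHAT.  §0 `reslack`, `credits_reslack_add_birthWT_le`, `pshapeTH_mul_exp_birthWT_le_reslack`; §1 **`structure CountRoadWitnessT3bWTVS D C O θᵥ …`**
(IR-44-1 (3)); §2 **`CountRoadWitnessT3bWTVS.toWTV : … → CountRoadWitnessT3bWTV D C (reslack O θᵥ) …`** (+ `toWTV_data`).

BY-NAME EFFECT (with the headline sibling): `priceM`∕`priceM′`'s volume part AND class remainder are kernel modulo the displays
`uV`∕`huV`; still READ: the CREDIT part (Q-44-1) and `resumM`.  v1.1 (leaf-02 gen 33 on OWNER WORD W-ne7bp1-g53-4, DOCSTRING ONLY — every declaration, binder, field, proof, `import` and `open` line of v1 = p265435 byte-identical) = SUPERSESSION-OF-RECORD MARKING (referee OI-77 «VS»; R-OWNER-48-1 «THE GUARDED CUT»): SUPERSEDED IN PLACE FOR INHABITATION — `CountRoadWitnessT3bWTVS` carries the field `disjointJoins` (:248) in the UNGUARDED currency `HistoryRealiseDistinct.DisjointJoins`, MISSTATED AS TYPED (unsatisfiable on non-trivial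 genealogies: `HistoryRealiseDistinctGuarded.Sanity.not_disjointJoins_nestedToy`), and `toWTV` (:370) hands it on to the owner's equally unguarded `CountRoadWitnessT3bWTV` (V, marked v1.1 p303678) — so neither witness's `hData` prefix is an honest hypothesis for the (α) assembly to inhabit; OF RECORD INSTEAD: the guarded twin `CountRoadWitnessT3bWTVSL` (`HistoryRealiseCellsRunApexT3bWTVSL` p283603 — THIS structure field for field, the field `disjointJoins` retyped to `DisjointJoinsL`, K on pass V by `InputFamily.disjointJoinsL_pedV`; embedding `CountRoadWitnessT3bWTVS.toL`) fed by the records `HistReadDataL`∕`LW`∕`LWD`∕`LWK`∕`LP`∕`LWL` (assemblies `…AssemblyWTVSL` p287559, `…LW` p290621, `…LWD` p295979, `…LWK` p298331, `…LP` p300321); §0's `reslack` ∕ `credits_reslack_add_birthWT_le` ∕ `pshapeTH_mul_exp_birthWT_le_reslack` are guard-free and REMAIN in use by the L-road (`…HeadlineT3bPWTVSL`); this module stays as the record of IR-44-1 (3) at the unguarded witness, its theorems true and its structure uninstantiated by the road of record.  HONEST: NE7b NOT proved; spine 0∕9.  HONEST DEPENDENCY (cell): continuum YM on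
T⁴ ⇐ BetaPertH ∧ nine spine estimates (0/9 proved); BetaPertH ⇐ (D1) ∧ (D4) ∧ CAP+tail; G-an2-4 gates asym, D1 and NE2/3/4.  Unchanged here. -/

open Finset MeasureTheory
open Literature.MathematicalPhysics.QuantumFieldTheory.Balaban1983to89
open T4PersistenceDictionary T4PersistentHistoryCount T4BankedInduction T4PrintedShapeBanking
open T4WeightBudget T4GlobalDenominator T4LiveClassFibration T4LiveStructureGas T4LiveGasToTerms T4RecordPriceSeam
open T4PartnerMultiplicity T4IndicatorShell T4MatchingAssembly T4MatchingClosure T4MatchingClosureSocket T4Continuum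
open T4StabilitySocket T4BranchingRecordsGas T4TaggedShapeBanking T4CanonicalMenus T4RenewalChains
open Summit.QuantumFields.BalabanUV.T4Continuum.PlacementBatch Summit.QuantumFields.BalabanUV.T4Continuum.PlacementSkeleton
open Summit.QuantumFields.BalabanUV.T4Continuum.CountThresholdUniform Summit.QuantumFields.BalabanUV.T4Continuum.CountThresholdExit
open Summit.QuantumFields.BalabanUV.T4Continuum.CountSeamJunction Summit.QuantumFields.BalabanUV.T4Continuum.LateMergers
open Summit.QuantumFields.BalabanUV.T4Continuum.HistoryFlow Summit.QuantumFields.BalabanUV.T4Continuum.HistoryRegeneration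
open Summit.QuantumFields.BalabanUV.T4Continuum.HistoryTables Summit.QuantumFields.BalabanUV.T4Continuum.HistoryAssemblyTrees
open Summit.QuantumFields.BalabanUV.T4Continuum.HistoryAssemblyTerms Summit.QuantumFields.BalabanUV.T4Continuum.HistoryAssemblyPedigree
open Summit.QuantumFields.BalabanUV.T4Continuum.HistoryConstants Summit.QuantumFields.BalabanUV.T4Continuum.HistoryGen
open Literature.MathematicalPhysics.QuantumFieldTheory.Balaban1983to89.B13ScaleTransfer
open Summit.QuantumFields.BalabanUV.T4Continuum.ZoneSkeleton Summit.QuantumFields.BalabanUV.T4Continuum.HistorySocketTH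
open Summit.QuantumFields.BalabanUV.T4Continuum.HistoryCaps Summit.QuantumFields.BalabanUV.T4Continuum.HistoryAssemblyPrice
open Summit.QuantumFields.BalabanUV.T4Continuum.HistoryBankingLE Summit.QuantumFields.BalabanUV.T4Continuum.HistoryExitLE
open Summit.QuantumFields.BalabanUV.T4Continuum.HistoryAssemblyTreesLE Summit.QuantumFields.BalabanUV.T4Continuum.HistoryAssemblyTermsLE
open Summit.QuantumFields.BalabanUV.T4Continuum.HistoryRealise Summit.QuantumFields.BalabanUV.T4Continuum.HistoryAssemblyRealiseLE
open Summit.QuantumFields.BalabanUV.T4Continuum.HistoryAssemblyMult Summit.QuantumFields.BalabanUV.T4Continuum.HistoryAssemblyMultKey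
open Summit.QuantumFields.BalabanUV.T4Continuum.HistoryAssemblyRealiseRun Summit.QuantumFields.BalabanUV.T4Continuum.HistoryAssemblyRealiseMult
open Summit.QuantumFields.BalabanUV.T4Continuum.HistoryZones Summit.QuantumFields.BalabanUV.T4Continuum.HistoryRealiseCells
open Summit.QuantumFields.BalabanUV.T4Continuum.HistoryRealiseCellsRun Summit.QuantumFields.BalabanUV.T4Continuum.HistoryAssemblyRealiseRunMult
open Summit.QuantumFields.BalabanUV.T4Continuum.HistoryRealiseCellsRunMult Summit.QuantumFields.BalabanUV.T4Continuum.HistoryAssemblyMultInstance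
open Summit.QuantumFields.BalabanUV.T4Continuum.HistoryJoinsPlacedMember Summit.QuantumFields.BalabanUV.T4Continuum.PlacementSkeleton
open Summit.QuantumFields.BalabanUV.T4Continuum.HistoryJoinsPlacedMult Summit.QuantumFields.BalabanUV.T4Continuum.HistoryRealiseDistinct
open Summit.QuantumFields.BalabanUV.T4Continuum.HistoryRegionTemplates Summit.QuantumFields.BalabanUV.T4Continuum.HistoryCaps
open Summit.QuantumFields.BalabanUV.T4Continuum.HistoryZoneEvolve (cth)
open Literature.MathematicalPhysics.QuantumFieldTheory.Balaban1983to89.B16SProfile (DropCtl)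
open Summit.QuantumFields.BalabanUV.T4Continuum.HistoryRealiseCellsRunMultEnd Summit.QuantumFields.BalabanUV.T4Continuum.HistoryRealiseCellsRunMultEndD
open Summit.QuantumFields.BalabanUV.T4Continuum.HistoryRealiseCellsRunPinnedT3b Summit.QuantumFields.BalabanUV.T4Continuum.HistoryHybridRescale
open Summit.QuantumFields.BalabanUV.T4Continuum.HistoryRealiseCellsRunApex (exists_const_schemeZ)
open Summit.QuantumFields.BalabanUV.T4Continuum.HistoryRealisePrint Summit.QuantumFields.BalabanUV.T4Continuum.HistoryRealiseWeak
open Summit.QuantumFields.BalabanUV.T4Continuum.HistoryRealisePrintReading Summit.QuantumFields.BalabanUV.T4Continuum.HistoryRealiseWeakReading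
open Summit.QuantumFields.BalabanUV.T4Continuum.HistoryRealisePrintCells Summit.QuantumFields.BalabanUV.T4Continuum.HistoryRealiseWeakCells
open Summit.QuantumFields.BalabanUV.T4Continuum.HistoryRealiseCellsRunApexT3b Summit.QuantumFields.BalabanUV.T4Continuum.HistoryRealiseCellsRunApexT3bW

open Summit.QuantumFields.BalabanUV.T4Continuum.HistoryRealiseCellsRunApexT3bWT Summit.QuantumFields.BalabanUV.T4Continuum.HistoryRealiseCellsRunPinnedT3bWT
open Summit.QuantumFields.BalabanUV.T4Continuum.HistoryRealiseCellsRunHeadlineT3bWT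
open Summit.QuantumFields.BalabanUV.T4Continuum.HistoryRealiseCellsRunApexT3bWTV Summit.QuantumFields.BalabanUV.T4Continuum.HistoryBankingVolumePlug

namespace Summit.QuantumFields.BalabanUV.T4Continuum.HistoryRealiseCellsRunApexT3bWTVS

noncomputable section

/-! ## §0 Re-slacking print's `O(1)` record absorbs a `p₀²`-weighted class remainder into the birth credit -/

section Reslack

variable {ε : Type*} [DecidableEq ε] (sh : ε → PEv) {O : PrintedO1s} {C : T4PrintedShapeBanking.Consts} {θv : ℝ}

/-- **THE RE-SLACKED `O(1)` RECORD**: `γ₀ := γ₀·A₁² − 2θᵥ`, `A₁ := 1`, every other constant unchanged — so that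
`½γ₀′A₁′² = ½γ₀A₁² − θᵥ` ([our object]; a bookkeeping device, not a printed record). [folklore] -/
def reslack (O : PrintedO1s) (θv : ℝ) : PrintedO1s :=
  { O with γ₀ := O.γ₀ * O.A₁ ^ 2 - 2 * θv, A₁ := 1 }

/-- the re-slacked `γ₀` [folklore] -/
@[simp] theorem reslack_γ₀ (O : PrintedO1s) (θv : ℝ) : (reslack O θv).γ₀ = O.γ₀ * O.A₁ ^ 2 - 2 * θv := rfl

/-- the re-slacked `A₁` [folklore] -/
@[simp] theorem reslack_A₁ (O : PrintedO1s) (θv : ℝ) : (reslack O θv).A₁ = 1 := rfl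

/-- **THE SLACK IDENTITY**: `½γ₀′A₁′² = ½γ₀A₁² − θᵥ`. [folklore] -/
theorem reslack_half (O : PrintedO1s) (θv : ℝ) :
    (reslack O θv).γ₀ * (reslack O θv).A₁ ^ 2 / 2 = O.γ₀ * O.A₁ ^ 2 / 2 - θv := by
  rw [reslack_γ₀, reslack_A₁]; ring

/-- the split slack `C.a + (θ + θᵥ) ≤ ½γ₀A₁²` IS the plain slack `C.a + θ ≤ ½γ₀′A₁′²` of the re-slacked record [folklore] -/
theorem reslack_hslack {θ : ℝ} (h : C.a + (θ + θv) ≤ O.γ₀ * O.A₁ ^ 2 / 2) :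
    C.a + θ ≤ (reslack O θv).γ₀ * (reslack O θv).A₁ ^ 2 / 2 := by
  rw [reslack_half]; linarith

/-- **THE WEIGHTED CLASS CONTENT IS ABSORBED BY THE BIRTH CREDIT**: under D-V1 `u_j ≤ θᵥ·p₀(g_j)²` at the births of `G`,
`credits (pcredit (reslack O θᵥ)) G + birthWT sh u G ≤ credits (pcredit O) G` (births: `(½γ₀A₁² − θᵥ)p₀²(d′+1) + 2p₀ +
u_j(d′+1) ≤ ½γ₀A₁²p₀²(d′+1) + 2p₀`; renewals ∕ mergers: equal). [folklore] -/
theorem credits_reslack_add_birthWT_le (g : ℕ → ℝ) {u : ℕ → ℝ} {G : Gen ε}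
    (hu : ∀ e ∈ G.events, (sh e).kind = 0 → u (sh e).step ≤ θv * p0Profile C.A₀ C.p₀ (g (sh e).step) ^ 2) :
    credits (pcredit (reslack O θv) C g ∘ sh) G + birthWT sh u G ≤ credits (pcredit O C g ∘ sh) G := by
  unfold credits birthWT
  rw [Finset.sum_filter, ← Finset.sum_add_distrib]
  refine Finset.sum_le_sum fun e he => ?_
  simp only [Function.comp_apply]
  by_cases h0 : (sh e).kind = 0
  · rw [if_pos h0, pcredit_kind0 h0, pcredit_kind0 h0, reslack_γ₀, reslack_A₁]
    have h1 := hu e he h0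
    have hf : (0 : ℝ) ≤ ((sh e).fat : ℝ) + 1 := by positivity
    nlinarith [mul_le_mul_of_nonneg_right h1 hf]
  · rw [if_neg h0, add_zero]
    by_cases h1 : (sh e).kind = 1
    · rw [pcredit_kind1 h1, pcredit_kind1 h1]
    · have h2 : (sh e).kind = 2 := by
        generalize hk : (sh e).kind = k at h0 h1 ⊢
        fin_cases k <;> simp_all
      rw [pcredit_kind2 h2, pcredit_kind2 h2]

/-- **PRINT-PRICED TH SHAPE × WEIGHTED CLASS FACTOR ≤ THE PRINT-PRICED TH SHAPE OF THE RE-SLACKED RECORD** (same realised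
cost `κ`, `Δ, Λ′ ≥ 0`), under D-V1 at the births. [folklore] -/
theorem pshapeTH_mul_exp_birthWT_le_reslack {Δ Λ' : ℝ} (hΔ : 0 ≤ Δ) (hΛ : 0 ≤ Λ') (R : ℕ → ℕ) (g : ℕ → ℝ) (D : ℕ)
    (κ : Gen ε → ℕ → ℝ) {G : Gen ε} {u : ℕ → ℝ}
    (hu : ∀ e ∈ G.events, (sh e).kind = 0 → u (sh e).step ≤ θv * p0Profile C.A₀ C.p₀ (g (sh e).step) ^ 2) :
    pshapeTH sh O C Δ Λ' R g D κ G * Real.exp (birthWT sh u G) ≤ pshapeTH sh (reslack O θv) C Δ Λ' R g D κ G := by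
  unfold pshapeTH
  have hc : Real.exp (-credits (pcredit O C g ∘ sh) G) * Real.exp (birthWT sh u G) ≤
      Real.exp (-credits (pcredit (reslack O θv) C g ∘ sh) G) := by
    rw [← Real.exp_add]
    exact Real.exp_le_exp.2 (by linarith [credits_reslack_add_birthWT_le sh (O := O) (C := C) g hu])
  have hpre : 0 ≤ Δ * Λ' ^ partnerAges (PEv.step ∘ sh) G := mul_nonneg hΔ (pow_nonneg hΛ _)
  calc _ = Δ * Λ' ^ partnerAges (PEv.step ∘ sh) G * (Real.exp (-credits (pcredit O C g ∘ sh) G) *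
        Real.exp (birthWT sh u G) * Real.exp (lifeCost (padW (dictWT sh R C.n₁) D) κ G)) := by ring
    _ ≤ Δ * Λ' ^ partnerAges (PEv.step ∘ sh) G * (Real.exp (-credits (pcredit (reslack O θv) C g ∘ sh) G) *
        Real.exp (lifeCost (padW (dictWT sh R C.n₁) D) κ G)) :=
      mul_le_mul_of_nonneg_left (mul_le_mul_of_nonneg_right hc (Real.exp_pos _).le) hpre
    _ = _ := by ring

end Reslack

section Apex

variable {F : T4Family} {G : Type*} [GaugeGroup G] [MeasurableSpace G] [HaarData G] [RegularGaugeGroup G]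

/-! ## §1 The witness with the weighted class remainder displayed (IR-44-1 (3)) -/

/-- **A COUNT-ROAD WITNESS OVER END v3′, MEMORY-AGNOSTIC CARRIER, `κ := costT`, WITH THE WEIGHTED CLASS REMAINDER DISPLAYED**
(HYPOTHESIS SHAPE — data + END v3′'s displayed binders, NOTHING asserted): the owner's `CountRoadWitnessT3bWTV` (p263890) FIELD
FOR FIELD, plus ONE displayed weight family `uV : ℕ → ℕ → ℝ` with its display `huV` (D-V1: `uV K j ≤ θᵥ·p₀(g_j)²` at the
births of the priced members), and the price sentences `priceM`∕`priceM′` carrying the factor `Real.exp (birthWT Prod.fst (uV K)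
q.2)` between `pshapeTH … (costT …) q.2` and the displayed discount `exp(−Ξ)` (INTERFACE REQUEST NE7b IR-44-1 (3), shapes
exact).  Every other field is the owner's TOKEN FOR TOKEN. [folklore] -/
structure CountRoadWitnessT3bWTVS (D : FiniteEpsData F G) (C : T4PrintedShapeBanking.Consts) (O : PrintedO1s) (θv : ℝ)
    (rr d n : ℕ) (hn : 0 < n) (g₀ : ℕ → ℝ) (os : List (ULoop F)) (ι α π : Type) [DecidableEq ι] [DecidableEq α]
    [DecidableEq π] : Type where
  /-- the source radius -/
  l₀ : ℝ
  /-- the volume factor of the matching remainders -/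
  vol : ℝ
  /-- the source radius is positive -/
  l₀_pos : 0 < l₀
  /-- the volume factor is positive -/
  vol_pos : 0 < vol
  /-- the threshold in the number of steps -/
  K₀ : ℕ
  /-- the term families -/
  T : ℕ → Finset ι
  /-- run A's term weights (`K` steps) -/
  A : ℕ → ℝ → ι → ℝ
  /-- run B's term weights (`K + 1` steps) -/
  A' : ℕ → ℝ → ι → ℝ
  /-- the two runs' shell parts (NE7c) -/
  (shA shB : ℕ → ℝ → ι → ℝ)
  /-- the two runs' dead weights (numerator reading) -/
  (dead dead' : ℕ → ℝ → ι → ℝ)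
  /-- the two runs' upper normalisation envelopes -/
  (nup mup : ℕ → ℝ → ℝ)
  /-- the common envelope bound -/
  Nup : ℝ
  /-- NE7 core budget data (`ReindexedBudget`) -/
  (Cc Rr CcRec RrRec : ℕ → ℝ → ι → ℝ)
  /-- NE7 core budget rates; `u s₂ r s` summable -/
  (ν u s₂ q₀ r s : ℕ → ℝ)
  /-- NE7c's shell weight budget -/
  Wsh : ℕ → ℝ
  /-- E1 REPRESENTATION (Bałaban's normalisation): run A's terms sum to the dressed integral of `ρ₀` after `K` steps -/
  reprA : ∀ K t, |t| ≤ l₀ → K₀ ≤ K →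
    ∫ U, Real.exp (t * T4GenFunBounds.prodObs (D.scheme g₀) K os U) * D.dens K (g₀ K) 0 U ∂fieldMeasure (F.P K) 0 G =
      ∑ τ ∈ T K, A K t τ
  /-- E2 REPRESENTATION: run B's terms sum to the dressed integral of `ρ₀` after `K + 1` steps -/
  reprB : ∀ K t, |t| ≤ l₀ → K₀ ≤ K →
    ∫ U, Real.exp (t * T4GenFunBounds.prodObs (D.scheme g₀) (K + 1) os U) * D.dens (K + 1) (g₀ (K + 1)) 0 U
        ∂fieldMeasure (F.P (K + 1)) 0 G = ∑ τ ∈ T K, A' K t τ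
  /-- the (γ) small-field mass floor -/
  c₀ : ℝ
  /-- the site budget -/
  n₁ : ℝ
  /-- the floor is positive -/
  c₀_pos : 0 < c₀
  /-- (γ) floor, run A -/
  floor : ∀ K, K₀ ≤ K → c₀ ≤ smallFieldMass D K (g₀ K)
  /-- (γ) floor, run B -/
  floor' : ∀ K, K₀ ≤ K → c₀ ≤ smallFieldMass D (K + 1) (g₀ (K + 1))
  /-- site budget, run A -/
  sites : ∀ K, K₀ ≤ K → ((D.C ⟨K, F.m, g₀ K⟩).numSites K : ℝ) ≤ n₁
  /-- site budget, run B -/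
  sites' : ∀ K, K₀ ≤ K → ((D.C ⟨K + 1, F.m, g₀ (K + 1)⟩).numSites (K + 1) : ℝ) ≤ n₁
  /-- the envelope bound is nonnegative -/
  Nup_nonneg : 0 ≤ Nup
  /-- envelope, run A -/
  nup_bd : ∀ K t, |t| ≤ l₀ → K₀ ≤ K → 0 ≤ nup K t ∧ nup K t ≤ Nup
  /-- envelope, run B -/
  mup_bd : ∀ K t, |t| ≤ l₀ → K₀ ≤ K → 0 ≤ mup K t ∧ mup K t ≤ Nup
  /-- the size function of (2.5) -/
  R : ℕ → ℕ → ℕ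
  /-- (2.5): `R K s` is an admissible size for the running coupling at step `s` -/
  isRj : ∀ K s, s ≤ K → B14.IsRj F.L rr ((D.C ⟨K, F.m, g₀ K⟩).flow.g s) (R K s)
  /-- sizes are at least one -/
  one_le_R : ∀ K, K₀ ≤ K → ∀ t, 1 ≤ R K t
  /-- H3: the reading map, pedigrees -/
  ped : ℕ → ι → Pedigree α π
  /-- H3: the reading map, root data of the live components -/
  cellP : ℕ → ι → π → Pt d × Finset (Pt d)
  /-- H3: the reading map, live components of each term -/
  liveC : ℕ → ι → Finset α
  /-- H3: the reading map, domains -/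
  Zd : ℕ → ι → α → Finset (Pt d)
  /-- H3: the pedigrees are WEAKLY (memory-agnostically) REALISED by the run's own profile with their domains:
  `real := RealisesW … ∧ PendingBefore … K` (leaf-03's IR-41-4 (3) carrier over the owner's core `RealisesW`) -/
  realised : RealisedDomainsRW F.L (runProfile F.L R) n K₀ R T ped cellP liveC Zd
  /-- H3: live components are dated no later than the cutoff -/
  step_le : ∀ K, K₀ ≤ K → ∀ τ ∈ T K, ∀ c ∈ liveC K τ, (ped K τ).step c ≤ K
  /-- H3 (row S1c-opt reading clause): DISTINCT partners at every join of a live component's member -/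
  disjointJoins : ∀ K, K₀ ≤ K → ∀ τ ∈ T K, ∀ c ∈ liveC K τ, DisjointJoins ((ped K τ).toPGen (cellP K τ) c)
  /-- H3 (row S1c-opt reading clause): constituents inside the torus' fundamental box at their birth levels -/
  boxedBirths : ∀ K, K₀ ≤ K → ∀ τ ∈ T K, ∀ c ∈ liveC K τ,
    BoxedBirths n F.L K (levelOf (runProfile F.L R K) K) ((ped K τ).toPGen (cellP K τ) c)
  /-- H3: live price ∕ dead-part resummation factors of the PHYSICAL member families, both runs -/
  (FcM RfM FcM' RfM' : ℕ → Finset ((Fin d → ℕ) × Gen PEv × Multiset (PEv × ((Fin d → ℕ) × Finset (Pt d)))) → ℝ)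
  /-- M5-2c: the displayed WEIGHT FAMILY of the volume remainder (per cutoff and birth step; the plug's `2^{d+3}·log Λ K j`) -/
  uV : ℕ → ℕ → ℝ
  /-- M5-2c, display D-V1 at the priced members' births: `uV K j ≤ θᵥ·p₀(g_j)²` (item (1)'s socket form `huV`) -/
  huV : ∀ K, K₀ ≤ K → ∀ τ ∈ badTerms (memOf ped liveC (cellOfR n F.L (runProfile F.L R) ped cellP)) jhalf T K,
    ∀ q ∈ memOf ped liveC (cellOfR n F.L (runProfile F.L R) ped cellP) K τ, ∀ e ∈ q.2.events, (Prod.fst e).kind = 0 →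
      uV K (Prod.fst e).step ≤ θv * p0Profile C.A₀ C.p₀ ((D.C ⟨K, F.m, g₀ K⟩).flow.g (Prod.fst e).step) ^ 2
  /-- H3: the per-term price sentence in print's currency at `κ := costT` WITH the weighted class remainder `exp (birthWT Prod.fst (uV K) q.2)` and the displayed discount `exp(−Ξ)`, run A -/
  priceM : ∀ K t, |t| ≤ l₀ → K₀ ≤ K → ∀ τ ∈ badTerms (memOf ped liveC (cellOfR n F.L (runProfile F.L R) ped cellP)) jhalf T K,
    FcM K (kmemOf ped liveC (cellOfR n F.L (runProfile F.L R) ped cellP) (physV n F.L hn (Nat.lt_of_lt_of_le Nat.zero_lt_two (two_le_L F))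
    (fun K => tcap d (dcapOf Prod.fst T (memOf ped liveC (cellOfR n F.L (runProfile F.L R) ped cellP)) K))
    (fun K => one_le_tcap d (dcapOf Prod.fst T (memOf ped liveC (cellOfR n F.L (runProfile F.L R) ped cellP)) K)) (runProfile F.L R) ped cellP) K τ) * RfM K (kmemOf ped liveC (cellOfR n F.L (runProfile F.L R) ped cellP) (physV n F.L hn (Nat.lt_of_lt_of_le Nat.zero_lt_two (two_le_L F))
    (fun K => tcap d (dcapOf Prod.fst T (memOf ped liveC (cellOfR n F.L (runProfile F.L R) ped cellP)) K))
    (fun K => one_le_tcap d (dcapOf Prod.fst T (memOf ped liveC (cellOfR n F.L (runProfile F.L R) ped cellP)) K)) (runProfile F.L R) ped cellP) K τ) ≤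
    ∏ q ∈ memOf ped liveC (cellOfR n F.L (runProfile F.L R) ped cellP) K τ,
    pshapeTH Prod.fst O C 1 1 (R K) (D.C ⟨K, F.m, g₀ K⟩).flow.g 0 (costT Prod.fst C K (R K)) q.2 * Real.exp (birthWT Prod.fst (uV K) q.2) *
      Real.exp (-(8 / C.E₂ * totalCostT Prod.fst C K (R K) q.2 + 4 * (partnerAges (PEv.step ∘ Prod.fst) q.2 : ℝ)))
  /-- H3: the per-term price sentence at `κ := costT` WITH the weighted class remainder and the displayed discount, run B -/
  priceM' : ∀ K t, |t| ≤ l₀ → K₀ ≤ K → ∀ τ ∈ badTerms (memOf ped liveC (cellOfR n F.L (runProfile F.L R) ped cellP)) jhalf T K,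
    FcM' K (kmemOf ped liveC (cellOfR n F.L (runProfile F.L R) ped cellP) (physV n F.L hn (Nat.lt_of_lt_of_le Nat.zero_lt_two (two_le_L F))
    (fun K => tcap d (dcapOf Prod.fst T (memOf ped liveC (cellOfR n F.L (runProfile F.L R) ped cellP)) K))
    (fun K => one_le_tcap d (dcapOf Prod.fst T (memOf ped liveC (cellOfR n F.L (runProfile F.L R) ped cellP)) K)) (runProfile F.L R) ped cellP) K τ) * RfM' K (kmemOf ped liveC (cellOfR n F.L (runProfile F.L R) ped cellP) (physV n F.L hn (Nat.lt_of_lt_of_le Nat.zero_lt_two (two_le_L F))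
    (fun K => tcap d (dcapOf Prod.fst T (memOf ped liveC (cellOfR n F.L (runProfile F.L R) ped cellP)) K))
    (fun K => one_le_tcap d (dcapOf Prod.fst T (memOf ped liveC (cellOfR n F.L (runProfile F.L R) ped cellP)) K)) (runProfile F.L R) ped cellP) K τ) ≤
    ∏ q ∈ memOf ped liveC (cellOfR n F.L (runProfile F.L R) ped cellP) K τ,
    pshapeTH Prod.fst O C 1 1 (R K) (D.C ⟨K, F.m, g₀ K⟩).flow.g 0 (costT Prod.fst C K (R K)) q.2 * Real.exp (birthWT Prod.fst (uV K) q.2) *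
      Real.exp (-(8 / C.E₂ * totalCostT Prod.fst C K (R K) q.2 + 4 * (partnerAges (PEv.step ∘ Prod.fst) q.2 : ℝ)))
  /-- H3 numerator reading, run A: terms below dead weight × live price of the physical member family × envelope -/
  upM : ∀ K t, |t| ≤ l₀ → K₀ ≤ K →
    ∀ k ∈ badGMems (memOf ped liveC (cellOfR n F.L (runProfile F.L R) ped cellP)) jhalf T (kmemOf ped liveC (cellOfR n F.L (runProfile F.L R) ped cellP) (physV n F.L hn (Nat.lt_of_lt_of_le Nat.zero_lt_two (two_le_L F))
    (fun K => tcap d (dcapOf Prod.fst T (memOf ped liveC (cellOfR n F.L (runProfile F.L R) ped cellP)) K))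
    (fun K => one_le_tcap d (dcapOf Prod.fst T (memOf ped liveC (cellOfR n F.L (runProfile F.L R) ped cellP)) K)) (runProfile F.L R) ped cellP)) K,
    ∀ τ ∈ fibre (kmemOf ped liveC (cellOfR n F.L (runProfile F.L R) ped cellP) (physV n F.L hn (Nat.lt_of_lt_of_le Nat.zero_lt_two (two_le_L F))
    (fun K => tcap d (dcapOf Prod.fst T (memOf ped liveC (cellOfR n F.L (runProfile F.L R) ped cellP)) K))
    (fun K => one_le_tcap d (dcapOf Prod.fst T (memOf ped liveC (cellOfR n F.L (runProfile F.L R) ped cellP)) K)) (runProfile F.L R) ped cellP)) T K k, A K t τ ≤ dead K t τ * FcM K k * nup K t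
  /-- H3 numerator reading, run A: dead weights nonnegative -/
  deadM_nonneg : ∀ K t, |t| ≤ l₀ → K₀ ≤ K →
    ∀ k ∈ badGMems (memOf ped liveC (cellOfR n F.L (runProfile F.L R) ped cellP)) jhalf T (kmemOf ped liveC (cellOfR n F.L (runProfile F.L R) ped cellP) (physV n F.L hn (Nat.lt_of_lt_of_le Nat.zero_lt_two (two_le_L F))
    (fun K => tcap d (dcapOf Prod.fst T (memOf ped liveC (cellOfR n F.L (runProfile F.L R) ped cellP)) K))
    (fun K => one_le_tcap d (dcapOf Prod.fst T (memOf ped liveC (cellOfR n F.L (runProfile F.L R) ped cellP)) K)) (runProfile F.L R) ped cellP)) K,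
    ∀ τ ∈ fibre (kmemOf ped liveC (cellOfR n F.L (runProfile F.L R) ped cellP) (physV n F.L hn (Nat.lt_of_lt_of_le Nat.zero_lt_two (two_le_L F))
    (fun K => tcap d (dcapOf Prod.fst T (memOf ped liveC (cellOfR n F.L (runProfile F.L R) ped cellP)) K))
    (fun K => one_le_tcap d (dcapOf Prod.fst T (memOf ped liveC (cellOfR n F.L (runProfile F.L R) ped cellP)) K)) (runProfile F.L R) ped cellP)) T K k, 0 ≤ dead K t τ
  /-- H3 numerator reading, run A: the dead-part resummation over terms with EQUAL physical live data -/
  resumM : ∀ K t, |t| ≤ l₀ → K₀ ≤ K →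
    ∀ k ∈ badGMems (memOf ped liveC (cellOfR n F.L (runProfile F.L R) ped cellP)) jhalf T (kmemOf ped liveC (cellOfR n F.L (runProfile F.L R) ped cellP) (physV n F.L hn (Nat.lt_of_lt_of_le Nat.zero_lt_two (two_le_L F))
    (fun K => tcap d (dcapOf Prod.fst T (memOf ped liveC (cellOfR n F.L (runProfile F.L R) ped cellP)) K))
    (fun K => one_le_tcap d (dcapOf Prod.fst T (memOf ped liveC (cellOfR n F.L (runProfile F.L R) ped cellP)) K)) (runProfile F.L R) ped cellP)) K,
    ∑ τ ∈ fibre (kmemOf ped liveC (cellOfR n F.L (runProfile F.L R) ped cellP) (physV n F.L hn (Nat.lt_of_lt_of_le Nat.zero_lt_two (two_le_L F))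
    (fun K => tcap d (dcapOf Prod.fst T (memOf ped liveC (cellOfR n F.L (runProfile F.L R) ped cellP)) K))
    (fun K => one_le_tcap d (dcapOf Prod.fst T (memOf ped liveC (cellOfR n F.L (runProfile F.L R) ped cellP)) K)) (runProfile F.L R) ped cellP)) T K k, dead K t τ ≤ RfM K k
  /-- H3 numerator reading, run A: live prices nonnegative -/
  FM_nonneg : ∀ K t, |t| ≤ l₀ → K₀ ≤ K →
    ∀ k ∈ badGMems (memOf ped liveC (cellOfR n F.L (runProfile F.L R) ped cellP)) jhalf T (kmemOf ped liveC (cellOfR n F.L (runProfile F.L R) ped cellP) (physV n F.L hn (Nat.lt_of_lt_of_le Nat.zero_lt_two (two_le_L F))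
    (fun K => tcap d (dcapOf Prod.fst T (memOf ped liveC (cellOfR n F.L (runProfile F.L R) ped cellP)) K))
    (fun K => one_le_tcap d (dcapOf Prod.fst T (memOf ped liveC (cellOfR n F.L (runProfile F.L R) ped cellP)) K)) (runProfile F.L R) ped cellP)) K, 0 ≤ FcM K k
  /-- H3 numerator reading, run B -/
  upM' : ∀ K t, |t| ≤ l₀ → K₀ ≤ K →
    ∀ k ∈ badGMems (memOf ped liveC (cellOfR n F.L (runProfile F.L R) ped cellP)) jhalf T (kmemOf ped liveC (cellOfR n F.L (runProfile F.L R) ped cellP) (physV n F.L hn (Nat.lt_of_lt_of_le Nat.zero_lt_two (two_le_L F))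
    (fun K => tcap d (dcapOf Prod.fst T (memOf ped liveC (cellOfR n F.L (runProfile F.L R) ped cellP)) K))
    (fun K => one_le_tcap d (dcapOf Prod.fst T (memOf ped liveC (cellOfR n F.L (runProfile F.L R) ped cellP)) K)) (runProfile F.L R) ped cellP)) K,
    ∀ τ ∈ fibre (kmemOf ped liveC (cellOfR n F.L (runProfile F.L R) ped cellP) (physV n F.L hn (Nat.lt_of_lt_of_le Nat.zero_lt_two (two_le_L F))
    (fun K => tcap d (dcapOf Prod.fst T (memOf ped liveC (cellOfR n F.L (runProfile F.L R) ped cellP)) K))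
    (fun K => one_le_tcap d (dcapOf Prod.fst T (memOf ped liveC (cellOfR n F.L (runProfile F.L R) ped cellP)) K)) (runProfile F.L R) ped cellP)) T K k, A' K t τ ≤ dead' K t τ * FcM' K k * mup K t
  /-- H3 numerator reading, run B -/
  deadM'_nonneg : ∀ K t, |t| ≤ l₀ → K₀ ≤ K →
    ∀ k ∈ badGMems (memOf ped liveC (cellOfR n F.L (runProfile F.L R) ped cellP)) jhalf T (kmemOf ped liveC (cellOfR n F.L (runProfile F.L R) ped cellP) (physV n F.L hn (Nat.lt_of_lt_of_le Nat.zero_lt_two (two_le_L F))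
    (fun K => tcap d (dcapOf Prod.fst T (memOf ped liveC (cellOfR n F.L (runProfile F.L R) ped cellP)) K))
    (fun K => one_le_tcap d (dcapOf Prod.fst T (memOf ped liveC (cellOfR n F.L (runProfile F.L R) ped cellP)) K)) (runProfile F.L R) ped cellP)) K,
    ∀ τ ∈ fibre (kmemOf ped liveC (cellOfR n F.L (runProfile F.L R) ped cellP) (physV n F.L hn (Nat.lt_of_lt_of_le Nat.zero_lt_two (two_le_L F))
    (fun K => tcap d (dcapOf Prod.fst T (memOf ped liveC (cellOfR n F.L (runProfile F.L R) ped cellP)) K))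
    (fun K => one_le_tcap d (dcapOf Prod.fst T (memOf ped liveC (cellOfR n F.L (runProfile F.L R) ped cellP)) K)) (runProfile F.L R) ped cellP)) T K k, 0 ≤ dead' K t τ
  /-- H3 numerator reading, run B -/
  resumM' : ∀ K t, |t| ≤ l₀ → K₀ ≤ K →
    ∀ k ∈ badGMems (memOf ped liveC (cellOfR n F.L (runProfile F.L R) ped cellP)) jhalf T (kmemOf ped liveC (cellOfR n F.L (runProfile F.L R) ped cellP) (physV n F.L hn (Nat.lt_of_lt_of_le Nat.zero_lt_two (two_le_L F))
    (fun K => tcap d (dcapOf Prod.fst T (memOf ped liveC (cellOfR n F.L (runProfile F.L R) ped cellP)) K))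
    (fun K => one_le_tcap d (dcapOf Prod.fst T (memOf ped liveC (cellOfR n F.L (runProfile F.L R) ped cellP)) K)) (runProfile F.L R) ped cellP)) K,
    ∑ τ ∈ fibre (kmemOf ped liveC (cellOfR n F.L (runProfile F.L R) ped cellP) (physV n F.L hn (Nat.lt_of_lt_of_le Nat.zero_lt_two (two_le_L F))
    (fun K => tcap d (dcapOf Prod.fst T (memOf ped liveC (cellOfR n F.L (runProfile F.L R) ped cellP)) K))
    (fun K => one_le_tcap d (dcapOf Prod.fst T (memOf ped liveC (cellOfR n F.L (runProfile F.L R) ped cellP)) K)) (runProfile F.L R) ped cellP)) T K k, dead' K t τ ≤ RfM' K k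
  /-- H3 numerator reading, run B -/
  FM'_nonneg : ∀ K t, |t| ≤ l₀ → K₀ ≤ K →
    ∀ k ∈ badGMems (memOf ped liveC (cellOfR n F.L (runProfile F.L R) ped cellP)) jhalf T (kmemOf ped liveC (cellOfR n F.L (runProfile F.L R) ped cellP) (physV n F.L hn (Nat.lt_of_lt_of_le Nat.zero_lt_two (two_le_L F))
    (fun K => tcap d (dcapOf Prod.fst T (memOf ped liveC (cellOfR n F.L (runProfile F.L R) ped cellP)) K))
    (fun K => one_le_tcap d (dcapOf Prod.fst T (memOf ped liveC (cellOfR n F.L (runProfile F.L R) ped cellP)) K)) (runProfile F.L R) ped cellP)) K, 0 ≤ FcM' K k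
  /-- NE7c: the indicator shells' relative weight bound -/
  shell : ShellWeightBound l₀ T A A' shA shB Wsh
  /-- NE7: the core budget on the hybrid cores over the bad classes -/
  budget : ReindexedBudget l₀ vol T (fun K t τ => A K t τ - shA K t τ) (fun K t τ => A' K t τ - shB K t τ)
    (badOfClass (bstrOf Prod.fst (memOf ped liveC (cellOfR n F.L (runProfile F.L R) ped cellP))) T
    (fun K _ => badClasses Prod.fst (memOf ped liveC (cellOfR n F.L (runProfile F.L R) ped cellP)) jhalf T K)) Cc Rr CcRec RrRec ν u s₂ q₀ r s
  /-- summable rates -/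
  sum_r : Summable r
  /-- summable rates -/
  sum_u : Summable u
  /-- summable rates -/
  sum_s : Summable s
  /-- summable rates -/
  sum_s₂ : Summable s₂

/-! ## §2 The embedding into the owner's `κ := costT` witness over the re-slacked record -/

omit [RegularGaugeGroup G] in
/-- **A WEIGHTED WITNESS OVER `O` IS A `κ := costT` WITNESS OVER `reslack O θᵥ`**: every field copied; the price sentences
lose the factor `exp (birthWT Prod.fst (uV K) q.2)` into the re-slacked birth credit (`pshapeTH_mul_exp_birthWT_le_reslack` with
`huV`, member by member; `Δ = Λ′ = 1`, the discount factor is positive).  Hence every consequence of a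
`CountRoadWitnessT3bWTV` (the owner's apex input and V-headline) applies at `reslack O θᵥ`. [folklore] -/
def CountRoadWitnessT3bWTVS.toWTV {D : FiniteEpsData F G} {C : T4PrintedShapeBanking.Consts} {O : PrintedO1s} {θv : ℝ}
    {rr d n : ℕ} {hn : 0 < n} {g₀ : ℕ → ℝ} {os : List (ULoop F)} {ι α π : Type} [DecidableEq ι] [DecidableEq α]
    [DecidableEq π] (X : CountRoadWitnessT3bWTVS D C O θv rr d n hn g₀ os ι α π) :
    CountRoadWitnessT3bWTV D C (reslack O θv) rr d n hn g₀ os ι α π :=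
  { l₀ := X.l₀, vol := X.vol, l₀_pos := X.l₀_pos, vol_pos := X.vol_pos, K₀ := X.K₀, T := X.T, A := X.A, A' := X.A',
    shA := X.shA, shB := X.shB, dead := X.dead, dead' := X.dead', nup := X.nup, mup := X.mup, Nup := X.Nup, Cc :=
    X.Cc, Rr := X.Rr, CcRec := X.CcRec, RrRec := X.RrRec, ν := X.ν, u := X.u, s₂ := X.s₂, q₀ := X.q₀, r := X.r, s :=
    X.s, Wsh := X.Wsh, reprA := X.reprA, reprB := X.reprB, c₀ := X.c₀, n₁ := X.n₁, c₀_pos := X.c₀_pos, floor :=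
    X.floor, floor' := X.floor', sites := X.sites, sites' := X.sites', Nup_nonneg := X.Nup_nonneg, nup_bd :=
    X.nup_bd, mup_bd := X.mup_bd, R := X.R, isRj := X.isRj, one_le_R := X.one_le_R, ped := X.ped, cellP := X.cellP,
    liveC := X.liveC, Zd := X.Zd, realised := X.realised, step_le := X.step_le, disjointJoins := X.disjointJoins,
    boxedBirths := X.boxedBirths,
    FcM := X.FcM, RfM := X.RfM, FcM' := X.FcM', RfM' := X.RfM', priceM := fun K t ht hK τ hτ => (X.priceM K t ht hK τ hτ).trans
      (Finset.prod_le_prod (fun _ _ => mul_nonneg (mul_nonneg (pshapeTH_nonneg Prod.fst zero_le_one zero_le_one _ _ _ _ _)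
        (Real.exp_pos _).le) (Real.exp_pos _).le) fun q hq => mul_le_mul_of_nonneg_right
          (pshapeTH_mul_exp_birthWT_le_reslack Prod.fst zero_le_one zero_le_one _ _ _ _ (X.huV K hK τ hτ q hq))
          (Real.exp_pos _).le),
    priceM' := fun K t ht hK τ hτ => (X.priceM' K t ht hK τ hτ).trans
      (Finset.prod_le_prod (fun _ _ => mul_nonneg (mul_nonneg (pshapeTH_nonneg Prod.fst zero_le_one zero_le_one _ _ _ _ _)
        (Real.exp_pos _).le) (Real.exp_pos _).le) fun q hq => mul_le_mul_of_nonneg_right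
          (pshapeTH_mul_exp_birthWT_le_reslack Prod.fst zero_le_one zero_le_one _ _ _ _ (X.huV K hK τ hτ q hq))
          (Real.exp_pos _).le), upM := X.upM,
    deadM_nonneg := X.deadM_nonneg, resumM := X.resumM, FM_nonneg := X.FM_nonneg, upM' := X.upM', deadM'_nonneg :=
    X.deadM'_nonneg, resumM' := X.resumM', FM'_nonneg := X.FM'_nonneg, shell := X.shell, budget := X.budget, sum_r :=
    X.sum_r, sum_u := X.sum_u, sum_s := X.sum_s, sum_s₂ := X.sum_s₂ }

omit [RegularGaugeGroup G] in
/-- the embedding keeps the data the END reads (terms, weights, sizes, pedigrees, price factors) [folklore] -/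
theorem CountRoadWitnessT3bWTVS.toWTV_data {D : FiniteEpsData F G} {C : T4PrintedShapeBanking.Consts} {O : PrintedO1s}
    {θv : ℝ} {rr d n : ℕ} {hn : 0 < n} {g₀ : ℕ → ℝ} {os : List (ULoop F)} {ι α π : Type} [DecidableEq ι]
    [DecidableEq α] [DecidableEq π] (X : CountRoadWitnessT3bWTVS D C O θv rr d n hn g₀ os ι α π) :
    X.toWTV.T = X.T ∧ X.toWTV.A = X.A ∧ X.toWTV.A' = X.A' ∧ X.toWTV.R = X.R ∧ X.toWTV.ped = X.ped ∧
      X.toWTV.FcM = X.FcM ∧ X.toWTV.RfM = X.RfM :=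
  ⟨rfl, rfl, rfl, rfl, rfl, rfl, rfl⟩

end Apex

end

end Summit.QuantumFields.BalabanUV.T4Continuum.HistoryRealiseCellsRunApexT3bWTVS
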